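import Summits.AtomisticToContinuum.Crystallization.Theorems.FreeSplittingCertificatesStrictSplittingRuleFarPencilFlux4Integral
import Summits.AtomisticToContinuum.Crystallization.Theorems.FreeSplittingCertificatesStrictSplittingRuleFarPencilGrowthIntegral

/-!
# `StrictSplittingRule` (stmt-AtomisticToContinuum-12560): the weighted far pencil for the GENERIC flux along LINEAR-GROWTH and AFFINE-TAILED fields

Route `FreeSplittingCertificates`, crux r3 `StrictSplittingRule` (H12⋆ = `stub_coreJointCoercive`), unit b2b-freesplit-B gen 18.
VALUE = companion 2/3 of `…FarPencilFlux4.lean`: the decay bookkeeping of `…FarPencilGrowth` / `…FarPencilGrowthIntegral` (gen 12, written for the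
ONE flux `fpFlux` of the `17/200` pencil) re-run for the generic flux `fpFlux4 a b c n = aΦ₁ + bΦ₂ + cΦ₃ + nΨ₁` and the inflated demand
`fpNumI f_S f_A D C`, so that the integrability form `farPencil4_weighted_integral_le_of_integrable` (`…FarPencilFlux4Integral`) becomes a statement
about a CLASS OF FIELDS for ANY pointwise certificate — in particular for the inflated certificate D the assembly of H12⋆ cites (HOME CERT.md §23,
FAR-LEMMA-SPEC §14 (e) item (6)).  NOT a proof of H12⋆, NOT summit progress.

Content (asymptotics along `cocompact ℝ³`, gauges `‖y‖ᵏ`, sup norm):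
* along a field with `v = O(‖y‖)`, `∇v = O(1)` (`∇²v = O(1)` for the derivative): **`N(f_S,f_A,D,C) = O(‖y‖⁻⁶)`, `Φⱼ = O(‖y‖⁻⁵)`,
  `∂ₖΦⱼ = O(‖y‖⁻⁵)`** (`isBigO_fpNumI_gauge`, `isBigO_fpFlux4_gauge`, `isBigO_fpFlux4Deriv_gauge`; the new radial flux `Φ₃ = |x|⁻¹⁰⟪x,v⟫²x`
  decays like the others);
* integrability of the weighted densities with a bounded `C²` weight vanishing near the reference site (`…_of_growth`);
* **`farPencil4_weighted_integral_le_of_growth`** and **`farPencil4_weighted_integral_le_of_affineTail`**: for ANY pointwise certificate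
  `N + div Φ ≤ t·Den` (explicit `∀`-hypothesis), `v ∈ C²` of linear growth (resp. affine outside a ball, `v y = b + y·A` for `‖y‖ ≥ R`) and
  `χ ∈ C²` with `0 ∉ tsupport χ`, `χ, ∇χ = O(1)` (resp. `χ = 1` for `‖y‖ ≥ R`):  `∫ χ²·N ≤ t·∫ χ²·Den + ∫ 2χ⟪∇χ, Φ⟫`;
* `farPencilD_weighted_integral_le_of_affineTail`: the instance for the recommended certificate D (`t = 9/40`).
HONEST FRAMING: theorems about continuum test fields; the lattice→continuum transfer, the near certificate and the tail bookkeeping of the readout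
bonds are untouched; NOT a proof of H12⋆, NOT summit progress.
-/

noncomputable section

open MeasureTheory Topology Filter Asymptotics

namespace Summit.AtomisticToContinuum.Crystallization.Theorems.StrictSplittingRuleBirth

/-! ## Decay gauges of the generic densities along a field of linear growth -/

section growthVG
variable {v : (Fin 3 → ℝ) → (Fin 3 → ℝ)}
  (hvO : ∀ i, (fun y => v y i) =O[cocompact (Fin 3 → ℝ)] fun y => ‖y‖ ^ (1 : ℤ))
  (hGO : ∀ i j, (fun y => fpGrad v y i j) =O[cocompact (Fin 3 → ℝ)] fun y => ‖y‖ ^ (0 : ℤ))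
include hvO hGO

/-- **Inflated demand density `N(f_S,f_A,D,C)(y, v, ∇v) = O(‖y‖⁻⁶)`** along a linear-growth field. -/
theorem isBigO_fpNumI_gauge (fS fA D C : ℝ) :
    (fun y => fpNumI fS fA D C y (v y) (fpGrad v y)) =O[cocompact (Fin 3 → ℝ)] fun y => ‖y‖ ^ (-6 : ℤ) := by
  have h1 : (fun y => fS * (1 / 24 * (fpSq y)⁻¹ ^ 3 * fpSymSq (fpGrad v y))) =O[cocompact (Fin 3 → ℝ)]
      fun y => ‖y‖ ^ (-6 : ℤ) :=
    (isBigO_gauge_up (isBigO_gauge_mul' (isBigO_gauge_mul' (isBigO_const_gauge (1 / 24))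
      (isBigO_fpSq_inv_pow_gauge 3)) (isBigO_symSq_gauge hGO)) (by norm_num)).const_mul_left fS
  have h2 : (fun y => fA * (1 / 24 * (fpSq y)⁻¹ ^ 3 * (fpFrob (fpGrad v y) - fpSymSq (fpGrad v y)))) =O[cocompact (Fin 3 → ℝ)]
      fun y => ‖y‖ ^ (-6 : ℤ) :=
    (isBigO_gauge_up (isBigO_gauge_mul' (isBigO_gauge_mul' (isBigO_const_gauge (1 / 24))
      (isBigO_fpSq_inv_pow_gauge 3)) ((isBigO_frob_gauge hGO).sub (isBigO_symSq_gauge hGO))) (by norm_num)).const_mul_left fA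
  have h3 : (fun y => (7 * D + C) / 4 * (fpSq y)⁻¹ ^ 5 * fpDot y (v y) ^ 2) =O[cocompact (Fin 3 → ℝ)]
      fun y => ‖y‖ ^ (-6 : ℤ) :=
    isBigO_gauge_up (isBigO_gauge_mul' (isBigO_gauge_mul' (isBigO_const_gauge ((7 * D + C) / 4))
      (isBigO_fpSq_inv_pow_gauge 5)) (isBigO_gauge_pow (isBigO_vDot_gauge hvO) 2)) (by norm_num)
  have h4 : (fun y => C / 4 * (fpSq y)⁻¹ ^ 4 * (v y 0 ^ 2 + v y 1 ^ 2 + v y 2 ^ 2)) =O[cocompact (Fin 3 → ℝ)]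
      fun y => ‖y‖ ^ (-6 : ℤ) :=
    isBigO_gauge_up (isBigO_gauge_mul' (isBigO_gauge_mul' (isBigO_const_gauge (C / 4))
      (isBigO_fpSq_inv_pow_gauge 4)) (isBigO_vSq_gauge' hvO)) (by norm_num)
  exact ((h1.add h2).add h3).sub h4

/-- **Generic flux `Φⱼ = O(‖y‖⁻⁵)`** along a linear-growth field. -/
theorem isBigO_fpFlux4_gauge (a b c n : ℝ) (j : Fin 3) :
    (fun y => fpFlux4 a b c n v y j) =O[cocompact (Fin 3 → ℝ)] fun y => ‖y‖ ^ (-5 : ℤ) := by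
  have hA : (fun y => a * fpSq (v y) * y j + b * fpDot y (v y) * v y j) =O[cocompact (Fin 3 → ℝ)]
      fun y => ‖y‖ ^ (3 : ℤ) :=
    (isBigO_gauge_up (isBigO_gauge_mul' (isBigO_gauge_mul' (isBigO_const_gauge a) (isBigO_vSq_gauge hvO))
      (isBigO_coord_gauge j)) (by norm_num)).add
      (isBigO_gauge_up (isBigO_gauge_mul' (isBigO_gauge_mul' (isBigO_const_gauge b) (isBigO_vDot_gauge hvO))
        (hvO j)) (by norm_num))
  have h1 := isBigO_gauge_mul' (isBigO_fpSq_inv_pow_gauge 4) hA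
  have h2 : (fun y => c * ((fpSq y)⁻¹ ^ 5 * fpDot y (v y) ^ 2 * y j)) =O[cocompact (Fin 3 → ℝ)] fun y => ‖y‖ ^ (-5 : ℤ) :=
    (isBigO_gauge_up (isBigO_gauge_mul' (isBigO_gauge_mul' (isBigO_fpSq_inv_pow_gauge 5)
      (isBigO_gauge_pow (isBigO_vDot_gauge hvO) 2)) (isBigO_coord_gauge j)) (by norm_num)).const_mul_left c
  have h3 : (fun y => n * ((fpSq y)⁻¹ ^ 3 *
      (v y 0 * fpGrad v y 0 j + v y 1 * fpGrad v y 1 j + v y 2 * fpGrad v y 2 j - fpTr (fpGrad v y) * v y j)))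
      =O[cocompact (Fin 3 → ℝ)] fun y => ‖y‖ ^ (-5 : ℤ) :=
    (isBigO_gauge_up (isBigO_gauge_mul' (isBigO_fpSq_inv_pow_gauge 3) (isBigO_vGcol_gauge hvO hGO j))
      (by norm_num)).const_mul_left n
  exact ((isBigO_gauge_up h1 (by norm_num)).add h2).add h3

end growthVG

section growthH
variable {v : (Fin 3 → ℝ) → (Fin 3 → ℝ)}
  (hvO : ∀ i, (fun y => v y i) =O[cocompact (Fin 3 → ℝ)] fun y => ‖y‖ ^ (1 : ℤ))
  (hGO : ∀ i j, (fun y => fpGrad v y i j) =O[cocompact (Fin 3 → ℝ)] fun y => ‖y‖ ^ (0 : ℤ))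
  (hHO : ∀ k i j, (fun y => fpHess v y k i j) =O[cocompact (Fin 3 → ℝ)] fun y => ‖y‖ ^ (0 : ℤ))
include hvO hGO hHO

/-- **Generic flux derivative `∂ₖΦⱼ = O(‖y‖⁻⁵)`** along a field with `v = O(‖y‖)`, `∇v = O(1)`, `∇²v = O(1)`. -/
theorem isBigO_fpFlux4Deriv_gauge (a b c n : ℝ) (j k : Fin 3) :
    (fun y => fpFlux4Deriv a b c n v y j k) =O[cocompact (Fin 3 → ℝ)] fun y => ‖y‖ ^ (-5 : ℤ) := by
  -- the bracket `A = a|v|² yⱼ + b⟪y,v⟫vⱼ = O(‖y‖³)`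
  have hA : (fun y => a * fpSq (v y) * y j + b * fpDot y (v y) * v y j) =O[cocompact (Fin 3 → ℝ)]
      fun y => ‖y‖ ^ (3 : ℤ) :=
    (isBigO_gauge_up (isBigO_gauge_mul' (isBigO_gauge_mul' (isBigO_const_gauge a) (isBigO_vSq_gauge hvO))
      (isBigO_coord_gauge j)) (by norm_num)).add
      (isBigO_gauge_up (isBigO_gauge_mul' (isBigO_gauge_mul' (isBigO_const_gauge b) (isBigO_vDot_gauge hvO))
        (hvO j)) (by norm_num))
  -- T1 = −8⟪y,eₖ⟫·s⁻⁵·A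
  have hT1 : (fun y => -8 * fpDot y (fpE k) * (fpSq y)⁻¹ ^ 5 * (a * fpSq (v y) * y j + b * fpDot y (v y) * v y j))
      =O[cocompact (Fin 3 → ℝ)] fun y => ‖y‖ ^ (-5 : ℤ) :=
    isBigO_gauge_up (isBigO_gauge_mul' (isBigO_gauge_mul' (isBigO_gauge_mul' (isBigO_const_gauge (-8))
      (isBigO_dotE_gauge k)) (isBigO_fpSq_inv_pow_gauge 5)) hA) (by norm_num)
  -- T2 = s⁻⁴·B with B = O(‖y‖²)
  have hB1 : (fun y => a * (2 * (v y 0 * fpGrad v y k 0 + v y 1 * fpGrad v y k 1 + v y 2 * fpGrad v y k 2)) * y j)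
      =O[cocompact (Fin 3 → ℝ)] fun y => ‖y‖ ^ (2 : ℤ) :=
    isBigO_gauge_up (isBigO_gauge_mul' (isBigO_gauge_mul' (isBigO_const_gauge a)
      ((isBigO_vGrow_gauge hvO hGO k).const_mul_left 2)) (isBigO_coord_gauge j)) (by norm_num)
  have hB2 : (fun y => a * fpSq (v y) * fpE k j) =O[cocompact (Fin 3 → ℝ)] fun y => ‖y‖ ^ (2 : ℤ) :=
    isBigO_gauge_up (isBigO_gauge_mul' (isBigO_gauge_mul' (isBigO_const_gauge a) (isBigO_vSq_gauge hvO))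
      (isBigO_const_gauge (fpE k j))) (by norm_num)
  have hB3 : (fun y => b * (fpDot (fpE k) (v y) + (y 0 * fpGrad v y k 0 + y 1 * fpGrad v y k 1 + y 2 * fpGrad v y k 2))
      * v y j) =O[cocompact (Fin 3 → ℝ)] fun y => ‖y‖ ^ (2 : ℤ) :=
    isBigO_gauge_up (isBigO_gauge_mul' (isBigO_gauge_mul' (isBigO_const_gauge b)
      ((isBigO_Edot_gauge hvO k).add (isBigO_xGrow_gauge hGO k))) (hvO j)) (by norm_num)
  have hB4 : (fun y => b * fpDot y (v y) * fpGrad v y k j) =O[cocompact (Fin 3 → ℝ)] fun y => ‖y‖ ^ (2 : ℤ) :=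
    isBigO_gauge_up (isBigO_gauge_mul' (isBigO_gauge_mul' (isBigO_const_gauge b) (isBigO_vDot_gauge hvO))
      (hGO k j)) (by norm_num)
  have hT2 := isBigO_gauge_up (isBigO_gauge_mul' (isBigO_fpSq_inv_pow_gauge 4) (((hB1.add hB2).add hB3).add hB4))
    (show -2 * ((4 : ℕ) : ℤ) + 2 ≤ -5 by norm_num)
  -- T3 = c·(−10⟪y,eₖ⟫s⁻⁶⟪y,v⟫²yⱼ + s⁻⁵(2⟪y,v⟫(⟪eₖ,v⟫ + Σᵢyᵢ∂ₖvᵢ)yⱼ + ⟪y,v⟫²(eₖ)ⱼ))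
  have hC1 : (fun y => -10 * fpDot y (fpE k) * (fpSq y)⁻¹ ^ 6 * fpDot y (v y) ^ 2 * y j)
      =O[cocompact (Fin 3 → ℝ)] fun y => ‖y‖ ^ (-5 : ℤ) :=
    isBigO_gauge_up (isBigO_gauge_mul' (isBigO_gauge_mul' (isBigO_gauge_mul' (isBigO_gauge_mul'
      (isBigO_const_gauge (-10)) (isBigO_dotE_gauge k)) (isBigO_fpSq_inv_pow_gauge 6))
      (isBigO_gauge_pow (isBigO_vDot_gauge hvO) 2)) (isBigO_coord_gauge j)) (by norm_num)
  have hC2 : (fun y => 2 * fpDot y (v y) *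
      (fpDot (fpE k) (v y) + (y 0 * fpGrad v y k 0 + y 1 * fpGrad v y k 1 + y 2 * fpGrad v y k 2)) * y j)
      =O[cocompact (Fin 3 → ℝ)] fun y => ‖y‖ ^ (4 : ℤ) :=
    isBigO_gauge_up (isBigO_gauge_mul' (isBigO_gauge_mul' (isBigO_gauge_mul' (isBigO_const_gauge 2)
      (isBigO_vDot_gauge hvO)) ((isBigO_Edot_gauge hvO k).add (isBigO_xGrow_gauge hGO k))) (isBigO_coord_gauge j))
      (by norm_num)
  have hC3 : (fun y => fpDot y (v y) ^ 2 * fpE k j) =O[cocompact (Fin 3 → ℝ)] fun y => ‖y‖ ^ (4 : ℤ) :=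
    isBigO_gauge_up (isBigO_gauge_mul' (isBigO_gauge_pow (isBigO_vDot_gauge hvO) 2) (isBigO_const_gauge (fpE k j)))
      (by norm_num)
  have hT3 : (fun y => c * (-10 * fpDot y (fpE k) * (fpSq y)⁻¹ ^ 6 * fpDot y (v y) ^ 2 * y j +
      (fpSq y)⁻¹ ^ 5 * (2 * fpDot y (v y) *
        (fpDot (fpE k) (v y) + (y 0 * fpGrad v y k 0 + y 1 * fpGrad v y k 1 + y 2 * fpGrad v y k 2)) * y j +
        fpDot y (v y) ^ 2 * fpE k j))) =O[cocompact (Fin 3 → ℝ)] fun y => ‖y‖ ^ (-5 : ℤ) :=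
    (hC1.add (isBigO_gauge_up (isBigO_gauge_mul' (isBigO_fpSq_inv_pow_gauge 5) (hC2.add hC3))
      (show -2 * ((5 : ℕ) : ℤ) + 4 ≤ -5 by norm_num))).const_mul_left c
  -- T4 = n·(−6⟪y,eₖ⟫s⁻⁴(Σᵢvᵢ∂ᵢvⱼ − (div v)vⱼ) + s⁻³·(O(1)))
  have hD1 : (fun y => -6 * fpDot y (fpE k) * (fpSq y)⁻¹ ^ 4 *
      (v y 0 * fpGrad v y 0 j + v y 1 * fpGrad v y 1 j + v y 2 * fpGrad v y 2 j - fpTr (fpGrad v y) * v y j))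
      =O[cocompact (Fin 3 → ℝ)] fun y => ‖y‖ ^ (-5 : ℤ) :=
    isBigO_gauge_up (isBigO_gauge_mul' (isBigO_gauge_mul' (isBigO_gauge_mul' (isBigO_const_gauge (-6))
      (isBigO_dotE_gauge k)) (isBigO_fpSq_inv_pow_gauge 4)) (isBigO_vGcol_gauge hvO hGO j)) (by norm_num)
  have hGG : (fun y => fpGrad v y k 0 * fpGrad v y 0 j + fpGrad v y k 1 * fpGrad v y 1 j + fpGrad v y k 2 * fpGrad v y 2 j)
      =O[cocompact (Fin 3 → ℝ)] fun y => ‖y‖ ^ (1 : ℤ) := by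
    have h : ∀ i : Fin 3, (fun y => fpGrad v y k i * fpGrad v y i j) =O[cocompact (Fin 3 → ℝ)]
        fun y => ‖y‖ ^ (1 : ℤ) :=
      fun i => isBigO_gauge_up (isBigO_gauge_mul' (hGO k i) (hGO i j)) (by norm_num)
    exact ((h 0).add (h 1)).add (h 2)
  have hvH : (fun y => v y 0 * fpHess v y k 0 j + v y 1 * fpHess v y k 1 j + v y 2 * fpHess v y k 2 j)
      =O[cocompact (Fin 3 → ℝ)] fun y => ‖y‖ ^ (1 : ℤ) := by
    have h : ∀ i : Fin 3, (fun y => v y i * fpHess v y k i j) =O[cocompact (Fin 3 → ℝ)] fun y => ‖y‖ ^ (1 : ℤ) :=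
      fun i => isBigO_gauge_up (isBigO_gauge_mul' (hvO i) (hHO k i j)) (by norm_num)
    exact ((h 0).add (h 1)).add (h 2)
  have htrH : (fun y => (fpHess v y k 0 0 + fpHess v y k 1 1 + fpHess v y k 2 2) * v y j)
      =O[cocompact (Fin 3 → ℝ)] fun y => ‖y‖ ^ (1 : ℤ) :=
    isBigO_gauge_up (isBigO_gauge_mul' (((hHO k 0 0).add (hHO k 1 1)).add (hHO k 2 2)) (hvO j)) (by norm_num)
  have htrG : (fun y => fpTr (fpGrad v y) * fpGrad v y k j) =O[cocompact (Fin 3 → ℝ)] fun y => ‖y‖ ^ (1 : ℤ) :=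
    isBigO_gauge_up (isBigO_gauge_mul' (isBigO_tr_gauge hGO) (hGO k j)) (by norm_num)
  have hT4 : (fun y => n * (-6 * fpDot y (fpE k) * (fpSq y)⁻¹ ^ 4 *
      (v y 0 * fpGrad v y 0 j + v y 1 * fpGrad v y 1 j + v y 2 * fpGrad v y 2 j - fpTr (fpGrad v y) * v y j) +
      (fpSq y)⁻¹ ^ 3 *
        (fpGrad v y k 0 * fpGrad v y 0 j + fpGrad v y k 1 * fpGrad v y 1 j + fpGrad v y k 2 * fpGrad v y 2 j +
          (v y 0 * fpHess v y k 0 j + v y 1 * fpHess v y k 1 j + v y 2 * fpHess v y k 2 j) -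
          (fpHess v y k 0 0 + fpHess v y k 1 1 + fpHess v y k 2 2) * v y j -
          fpTr (fpGrad v y) * fpGrad v y k j))) =O[cocompact (Fin 3 → ℝ)] fun y => ‖y‖ ^ (-5 : ℤ) :=
    (hD1.add (isBigO_gauge_up (isBigO_gauge_mul' (isBigO_fpSq_inv_pow_gauge 3) (((hGG.add hvH).sub htrH).sub htrG))
      (show -2 * ((3 : ℕ) : ℤ) + 1 ≤ -5 by norm_num))).const_mul_left n
  exact ((hT1.add hT2).add hT3).add hT4

end growthH

/-! ## Integrability of the weighted generic densities and the far pencil for the linear-growth class -/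

section main
variable {v : (Fin 3 → ℝ) → (Fin 3 → ℝ)} {χ : (Fin 3 → ℝ) → ℝ}
  (hv : ContDiff ℝ 2 v) (hχ : ContDiff ℝ 2 χ) (hχ0 : (0 : Fin 3 → ℝ) ∉ tsupport χ)
include hv hχ hχ0

/-- `χ²·N(f_S,f_A,D,C)` is integrable along a linear-growth field with a bounded weight vanishing near `0`. -/
theorem integrable_sq_mul_fpNumI_of_growth (fS fA D C : ℝ)
    (hvO : ∀ i, (fun y => v y i) =O[cocompact (Fin 3 → ℝ)] fun y => ‖y‖ ^ (1 : ℤ))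
    (hGO : ∀ i j, (fun y => fpGrad v y i j) =O[cocompact (Fin 3 → ℝ)] fun y => ‖y‖ ^ (0 : ℤ))
    (hχO : (fun y => χ y) =O[cocompact (Fin 3 → ℝ)] fun y => ‖y‖ ^ (0 : ℤ)) :
    Integrable fun y => χ y ^ 2 * fpNumI fS fA D C y (v y) (fpGrad v y) :=
  integrable_of_isBigO_gauge
    (continuous_weight_mul (hχ.continuous.pow 2) (chiSq_eventually_zero hχ0)
      fun y hy => continuousAt_fpNumI hv hy fS fA D C)
    (show (0 : ℤ) + -6 ≤ -4 by norm_num)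
    (isBigO_gauge_mul' (isBigO_chiSq_gauge hχO) (isBigO_fpNumI_gauge hvO hGO fS fA D C))

/-- `Φⱼ·χ²` is integrable along a linear-growth field with a bounded weight vanishing near `0` (generic flux). -/
theorem integrable_fpFlux4_mul_sq_of_growth (a b c n : ℝ)
    (hvO : ∀ i, (fun y => v y i) =O[cocompact (Fin 3 → ℝ)] fun y => ‖y‖ ^ (1 : ℤ))
    (hGO : ∀ i j, (fun y => fpGrad v y i j) =O[cocompact (Fin 3 → ℝ)] fun y => ‖y‖ ^ (0 : ℤ))
    (hχO : (fun y => χ y) =O[cocompact (Fin 3 → ℝ)] fun y => ‖y‖ ^ (0 : ℤ)) (j : Fin 3) :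
    Integrable fun y => fpFlux4 a b c n v y j * χ y ^ 2 :=
  integrable_of_isBigO_gauge
    (continuous_mul_weight (hχ.continuous.pow 2) (chiSq_eventually_zero hχ0)
      fun y hy => continuousAt_fpFlux4 a b c n hv hy j)
    (show (-5 : ℤ) + 0 ≤ -4 by norm_num)
    (isBigO_gauge_mul' (isBigO_fpFlux4_gauge hvO hGO a b c n j) (isBigO_chiSq_gauge hχO))

/-- `Φⱼ·(2χ∂ⱼχ)` is integrable along a linear-growth field with `χ, ∇χ = O(1)` (generic flux). -/
theorem integrable_fpFlux4_mul_grad_sq_of_growth (a b c n : ℝ)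
    (hvO : ∀ i, (fun y => v y i) =O[cocompact (Fin 3 → ℝ)] fun y => ‖y‖ ^ (1 : ℤ))
    (hGO : ∀ i j, (fun y => fpGrad v y i j) =O[cocompact (Fin 3 → ℝ)] fun y => ‖y‖ ^ (0 : ℤ))
    (hχO : (fun y => χ y) =O[cocompact (Fin 3 → ℝ)] fun y => ‖y‖ ^ (0 : ℤ))
    (hχ1 : ∀ j, (fun y => fpGradS χ y j) =O[cocompact (Fin 3 → ℝ)] fun y => ‖y‖ ^ (0 : ℤ)) (j : Fin 3) :
    Integrable fun y => fpFlux4 a b c n v y j * (2 * χ y * fpGradS χ y j) :=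
  integrable_of_isBigO_gauge
    (continuous_mul_weight (continuous_two_mul_chi_grad hχ j) (two_mul_chi_grad_eventually_zero hχ0 j)
      fun y hy => continuousAt_fpFlux4 a b c n hv hy j)
    (show (-5 : ℤ) + (0 + 0 + 0) ≤ -4 by norm_num)
    (isBigO_gauge_mul' (isBigO_fpFlux4_gauge hvO hGO a b c n j)
      (isBigO_gauge_mul' (isBigO_gauge_mul' (isBigO_const_gauge 2) hχO) (hχ1 j)))

/-- `∂ⱼΦⱼ·χ²` is integrable along a linear-growth field with `∇²v = O(1)` and a bounded weight vanishing near `0` (generic flux). -/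
theorem integrable_fpFlux4Deriv_mul_sq_of_growth (a b c n : ℝ)
    (hvO : ∀ i, (fun y => v y i) =O[cocompact (Fin 3 → ℝ)] fun y => ‖y‖ ^ (1 : ℤ))
    (hGO : ∀ i j, (fun y => fpGrad v y i j) =O[cocompact (Fin 3 → ℝ)] fun y => ‖y‖ ^ (0 : ℤ))
    (hHO : ∀ k i j, (fun y => fpHess v y k i j) =O[cocompact (Fin 3 → ℝ)] fun y => ‖y‖ ^ (0 : ℤ))
    (hχO : (fun y => χ y) =O[cocompact (Fin 3 → ℝ)] fun y => ‖y‖ ^ (0 : ℤ)) (j : Fin 3) :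
    Integrable fun y => fpFlux4Deriv a b c n v y j j * χ y ^ 2 :=
  integrable_of_isBigO_gauge
    (continuous_mul_weight (hχ.continuous.pow 2) (chiSq_eventually_zero hχ0)
      fun y hy => continuousAt_fpFlux4Deriv a b c n hv hy j j)
    (show (-5 : ℤ) + 0 ≤ -4 by norm_num)
    (isBigO_gauge_mul' (isBigO_fpFlux4Deriv_gauge hvO hGO hHO a b c n j j) (isBigO_chiSq_gauge hχO))

/-- **THE WEIGHTED FAR PENCIL FOR A GENERIC POINTWISE CERTIFICATE ON THE LINEAR-GROWTH CLASS.**  Let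
`N(f_S,f_A,D,C) + div(aΦ₁ + bΦ₂ + cΦ₃ + nΨ₁) ≤ t·Den` hold at every `x ≠ 0`; let `v : ℝ³ → ℝ³` be `C²` with `v = O(‖y‖)`, `∇v = O(1)`,
`∇²v = O(1)` at infinity, and `χ` a `C²` weight with `0 ∉ tsupport χ`, `χ = O(1)`, `∇χ = O(1)`.  Then
`∫ χ²·N(x, v, ∇v) ≤ t·∫ χ²·Den(x, ∇v) + ∫ 2χ⟪∇χ, Φ⟫`, all integrability hypotheses of
`farPencil4_weighted_integral_le_of_integrable` being discharged by the decay gauges.  NOT a proof of H12⋆, NOT summit progress. -/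
theorem farPencil4_weighted_integral_le_of_growth {fS fA D C a b c n t : ℝ}
    (hcert : ∀ (x v : Fin 3 → ℝ) (G : Fin 3 → Fin 3 → ℝ), x ≠ 0 → fpNumI fS fA D C x v G + fpDivFlux4 a b c n x v G ≤ t * fpDen x G)
    (hvO : ∀ i, (fun y => v y i) =O[cocompact (Fin 3 → ℝ)] fun y => ‖y‖ ^ (1 : ℤ))
    (hGO : ∀ i j, (fun y => fpGrad v y i j) =O[cocompact (Fin 3 → ℝ)] fun y => ‖y‖ ^ (0 : ℤ))
    (hHO : ∀ k i j, (fun y => fpHess v y k i j) =O[cocompact (Fin 3 → ℝ)] fun y => ‖y‖ ^ (0 : ℤ))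
    (hχO : (fun y => χ y) =O[cocompact (Fin 3 → ℝ)] fun y => ‖y‖ ^ (0 : ℤ))
    (hχ1 : ∀ j, (fun y => fpGradS χ y j) =O[cocompact (Fin 3 → ℝ)] fun y => ‖y‖ ^ (0 : ℤ)) :
    ∫ x, χ x ^ 2 * fpNumI fS fA D C x (v x) (fpGrad v x) ≤
      t * (∫ x, χ x ^ 2 * fpDen x (fpGrad v x)) + ∫ x, 2 * χ x * fpFlux4DotGrad a b c n v χ x :=
  farPencil4_weighted_integral_le_of_integrable hcert hv hχ hχ0
    (integrable_sq_mul_fpNumI_of_growth hv hχ hχ0 fS fA D C hvO hGO hχO)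
    (integrable_sq_mul_fpDen_of_growth hv hχ hχ0 hGO hχO)
    (integrable_fpFlux4Deriv_mul_sq_of_growth hv hχ hχ0 a b c n hvO hGO hHO hχO)
    (integrable_fpFlux4_mul_grad_sq_of_growth hv hχ hχ0 a b c n hvO hGO hχO hχ1)
    (integrable_fpFlux4_mul_sq_of_growth hv hχ hχ0 a b c n hvO hGO hχO)

end main

/-! ## The affine tail -/

section affine
variable {v : (Fin 3 → ℝ) → (Fin 3 → ℝ)} {χ : (Fin 3 → ℝ) → ℝ} {R : ℝ} {b₀ : Fin 3 → ℝ} {A : Fin 3 → Fin 3 → ℝ}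

/-- **THE WEIGHTED FAR PENCIL FOR A GENERIC POINTWISE CERTIFICATE ALONG AN AFFINE-TAILED FIELD** — the form the H12⋆ assembly consumes
for the inflated certificate it cites: `N + div Φ ≤ t·Den` pointwise at `x ≠ 0`; `v ∈ C²` affine outside a (sup-norm) ball, `v y = b₀ + y·A` for
`‖y‖ ≥ R`; `χ ∈ C²` with `0 ∉ tsupport χ` and `χ = 1` for `‖y‖ ≥ R`.  Then `∫ χ²·N ≤ t·∫ χ²·Den + ∫ 2χ⟪∇χ, Φ⟫` — no compact support, no
condition at the reference site, every integrability hypothesis discharged.  NOT a proof of H12⋆, NOT summit progress. -/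
theorem farPencil4_weighted_integral_le_of_affineTail {fS fA D C a b c n t : ℝ}
    (hcert : ∀ (x v : Fin 3 → ℝ) (G : Fin 3 → Fin 3 → ℝ), x ≠ 0 → fpNumI fS fA D C x v G + fpDivFlux4 a b c n x v G ≤ t * fpDen x G)
    (hv : ContDiff ℝ 2 v) (hχ : ContDiff ℝ 2 χ) (hχ0 : (0 : Fin 3 → ℝ) ∉ tsupport χ)
    (htail : ∀ y : Fin 3 → ℝ, R ≤ ‖y‖ → ∀ j, v y j = b₀ j + (y 0 * A 0 j + y 1 * A 1 j + y 2 * A 2 j))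
    (hχ1 : ∀ y : Fin 3 → ℝ, R ≤ ‖y‖ → χ y = 1) :
    ∫ x, χ x ^ 2 * fpNumI fS fA D C x (v x) (fpGrad v x) ≤
      t * (∫ x, χ x ^ 2 * fpDen x (fpGrad v x)) + ∫ x, 2 * χ x * fpFlux4DotGrad a b c n v χ x := by
  have hvO := isBigO_of_affineTail htail
  have hGO : ∀ i j, (fun y => fpGrad v y i j) =O[cocompact (Fin 3 → ℝ)] fun y => ‖y‖ ^ (0 : ℤ) := by
    intro i j
    refine IsBigO.of_bound ‖A i j‖ ?_
    filter_upwards [eventually_cocompact_norm_gt R] with y hy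
    rw [(fpGrad_fpHess_of_affineTail htail hy).1]
    simp
  have hHO : ∀ k i j, (fun y => fpHess v y k i j) =O[cocompact (Fin 3 → ℝ)] fun y => ‖y‖ ^ (0 : ℤ) := by
    intro k i j
    refine IsBigO.of_bound 0 ?_
    filter_upwards [eventually_cocompact_norm_gt R] with y hy
    rw [(fpGrad_fpHess_of_affineTail htail hy).2]
    simp
  have hχO : (fun y => χ y) =O[cocompact (Fin 3 → ℝ)] fun y => ‖y‖ ^ (0 : ℤ) := by
    refine IsBigO.of_bound 1 ?_
    filter_upwards [eventually_cocompact_norm_ge R] with y hy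
    rw [hχ1 y hy]
    simp
  have hχ1O : ∀ j, (fun y => fpGradS χ y j) =O[cocompact (Fin 3 → ℝ)] fun y => ‖y‖ ^ (0 : ℤ) := by
    intro j
    refine IsBigO.of_bound 0 ?_
    filter_upwards [eventually_cocompact_norm_gt R] with y hy
    rw [fpGradS_eq_zero_of_tail hχ1 hy]
    simp
  exact farPencil4_weighted_integral_le_of_growth hv hχ hχ0 hcert hvO hGO hHO hχO hχ1O

/-- **Instance: the recommended inflated certificate D along an affine-tailed field.**  For `v ∈ C²` with `v y = b₀ + y·A` for `‖y‖ ≥ R`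
and `χ ∈ C²` with `0 ∉ tsupport χ`, `χ = 1` for `‖y‖ ≥ R`:
`∫ χ²·N(7/4,7/4,6/5,9/10) ≤ (9/40)·∫ χ²·Den + ∫ 2χ⟪∇χ, Φ_D⟫`, `Φ_D = (7/45)Φ₁ + (23/30)Φ₂ − (19/40)Φ₃ + (3/40)Ψ₁`.
NOT a proof of H12⋆, NOT summit progress. -/
theorem farPencilD_weighted_integral_le_of_affineTail (hv : ContDiff ℝ 2 v) (hχ : ContDiff ℝ 2 χ)
    (hχ0 : (0 : Fin 3 → ℝ) ∉ tsupport χ)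
    (htail : ∀ y : Fin 3 → ℝ, R ≤ ‖y‖ → ∀ j, v y j = b₀ j + (y 0 * A 0 j + y 1 * A 1 j + y 2 * A 2 j))
    (hχ1 : ∀ y : Fin 3 → ℝ, R ≤ ‖y‖ → χ y = 1) :
    ∫ x, χ x ^ 2 * fpNumI (7 / 4) (7 / 4) (6 / 5) (9 / 10) x (v x) (fpGrad v x) ≤
      9 / 40 * (∫ x, χ x ^ 2 * fpDen x (fpGrad v x)) +
        ∫ x, 2 * χ x * fpFlux4DotGrad (7 / 45) (23 / 30) (-(19 / 40)) (3 / 40) v χ x :=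
  farPencil4_weighted_integral_le_of_affineTail farPencilCert_D hv hχ hχ0 htail hχ1

end affine

end Summit.AtomisticToContinuum.Crystallization.Theorems.StrictSplittingRuleBirth
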